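import Literature.MathematicalPhysics.QuantumFieldTheory.Balaban1983to89.B15Prop1WindowDirectPackageFromLetters
import Literature.MathematicalPhysics.QuantumFieldTheory.Balaban1983to89.B15Prop1NumericsThresholds

/-!
# BalabanUVNodes ∕ N12 — (P2c)″ `(iii)_direct` IN THE EXPLICIT-THRESHOLD FRAME WITH THE `hsb`-FREE CHART HALF: the lane's (P2c)′ with its chart-half letter re-keyed on dag-n12-c g21's ρ5c-2
# `N12DirectChartPackageOfClassFamily.exists_hWD_chartHalf_of_class_uniform_family` (LOCATED-HSB repair on the chart side) — the small-below letter `hsb` leaves this file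

Cell `pub-ymgap` (HUMAN RULINGS D-0062 ∕ D-0149), seat `pub-ymgap-dag-n12-d` g20 (R134 N12 [B15] s2; the v8 cascade of the lane's INTENT-7, INBOX l.43843: «(P2c)″ = (P2c)′ with binders
`(C ρ Kτ ρτ ρ5 : ι → ℝ)` + the new letter `hhalf″ i` (= (ρ5c-2)'s conjunct; NO `SmallBelow` premise) + rows `hkK hM4 hdiv` + ONE floor `hερ : ∀ i, 6(d−1)L·ν.εreg ≤ ρ5 i`, and `hsb` DROPPED»).
Count-neutral helper of K1⁹ `stmt-QuantumFields-27364` (`--kind proof --supports … --as helper`).  THEOREMS ONLY (0 `def`, 0 `instance`, 0 `sorry`); composition BY NAME of dag-n12-c's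
(ii)_direct §2 `B15Prop1WindowDirectPackageFromLetters.…_ofMinimiserFamily_ofWindowLetters_ofCoercive` (p658881) and `B15Prop1NumericsThresholds.hsm_direct_of_le_explicitThreshold` (§7).

WHY (LOCATED-HSB, lane census D4′).  The displayed small-below letter `hsb : SmallBelow (avOfRecord F 2 Kt) (k i) U₀` for every guarded minimiser is GLOBAL on the torus (the (0.4) small-field
condition of every iterated average at every coarse bond, also far from the support) — not derivable from the (2.12) class and without a producer.  On the chart side it entered only through
the chart half; dag-n12-c g21's ρ5a ∕ ρ5b ∕ ρ5c (`…N12ChartRegularityTowerProxies` p677066, `…N12TowerProxiesOfClass` p677953, `…N12DirectChartPackageOfClass(+Family)`) read the chart rows off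
GUARDED TOWER PROXIES supplied by the class instead, at the price of the numeric rows `k+1 ≤ m+K`, `4L ≤ M₁`, `6(d−1)L·εreg ≤ ρ5` (ρ5 = the per-height uniform curvature radius).

WHAT.  (P2c)′'s statement VERBATIM except: (a) the constants binder reads `(C ρ Kτ ρτ ρ5 : ι → ℝ)`; (b) `hhalf i` is the ∀-body of `exists_hWD_chartHalf_of_class_uniform_family` at `k i`
(after `hbox → hΩw →` it asks `k i + 1 ≤ m + K → 4L ≤ ν.M₁ → side L M₁ (k i) ∣ sitesPerDir 0 → 0 ≤ ν.εreg → 6(d−1)L·ν.εreg ≤ ρ5 i →` and then NO `SmallBelow`; the rest as before); (c) rows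
`hk1 : k i + 1 ≤ m + K` (in place of `hk`), `hM4 : 4L ≤ ν.M₁`, `hεreg : 0 < ν.εreg`, `hερ : ∀ i, 6(d−1)L·ν.εreg ≤ ρ5 i`; (d) the binder `hsb` is GONE.  The window gauge letter `hσW`, the
plaquette letter `hPχ`, the (P4)′ socket `hH` (+ `B hB0`), (P5) `M₂ hM₂0 hM₂`, (J0′) `hMin`, [15] Thm 1 `h15T`, geometry and numerics rows stay as in (P2c)′.  Downstream (this seat): (D1)″ (the
(P4)′ letter `hHB` at displayed `εH B` — its own premise still reads `SmallBelow`, so `hsb` is displayed THERE until dag-n12-w6's box-proxy (P4)′ lands), (E1)⁗, knit «v8».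

HONEST FRAMING ∕ LOCATED.  ∃∕∀ bookkeeping by name; nothing of Bałaban's asserted; count-neutral; N12 NOT discharged; K1⁹ NOT closed; counts unmoved; one finite 𝕋⁴ programme at fixed
`ε = L^{-K}` — R4 closes only the conditional rung `BalabanLadder.UV`; no summit statement is proved here and NOT the Yang–Mills mass gap (Clay); nothing continuum ∕ ℝ⁴ ∕ OS.

References: [Balaban1989LargeFieldI] CMP 122 (1989) 175–202, (1.74) p.192, Prop. 1 (1.77)–(1.78) p.194, (1.79) p.195; [Balaban1989LargeFieldII] CMP 122 (1989) 355–392, p.357,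
(1.7)–(1.9) p.358, (1.12)–(1.13) p.359; [Balaban1985Variational] CMP 102 (1985) 277–309, (2)–(4) p.278, Thm 1 (8) p.279, (44)–(48) p.285, (81)–(83) p.290; [Balaban1988Convergent]
CMP 119 (1988) 243–285, (2.2) p.255, (2.11)–(2.14) pp.256–257.
-/

noncomputable section

open Set Finset Metric Filter
open scoped BigOperators Matrix RealInnerProductSpace Real InnerProductSpace Topology Matrix.Norms.L2Operator

namespace Summit.QuantumFields.YangMills.BalabanUVNodes.N12Prop1DirectOfChartHalfOfClassExplicit

open Literature.MathematicalPhysics.QuantumFieldTheory.Balaban1983to89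
open T4Continuum B15DeterminingSets GaugeField B16Sect1Backgrounds B15Prop1Carrier B8Eq17ClassAkV1 BlockAveraging
open B15Prop1SliceTaylorCalculus
open B15Prop1ChartCalculusSU2 (E3)
open T4CubeChartGnomonic (SU2)
open B15Prop1ChartSU2 (su2Chart)
open B15Prop1SliceCoordinates (GaugeSlice ιA freeBonds)
open B15Prop1AnalyticExtClause (cplxVec anExt)
open T4AdjointCovarianceUnitary (lieSU)
open T4AxialGaugeSmallField (castSite boxPlaqs boxBonds)
open B6BondElimination (unitVec)
open B6TreeGaugePoincare (curl)
open B16Eq18Proof (box mem_box)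
open B15Extension193 (extend)
open B15ShellGauge193 (shellGauge)
open B14.Eq213MaximalDomains (side)
open B14.Eq213DetSet B14.Eq216Concrete B15Sect1Instances B15Eq177GaugeInvariance B15Eq177ValueInvariance B15Eq177ValueInvarianceCoDiv B16Sect1Wilson
open B14.Eq22Determines (blockIter IsBlockUnion)
open Literature.MathematicalPhysics.QuantumFieldTheory.BalabanImbrieJaffe1984to88.BIJ85Eq453GaugeField
open Node00 (expChart msChart constrCard)
open B15Prop1WindowDirectPackageFromLetters (exists_domain_prop1Printed_lfVarOn_std_su2_box_intrinsic_analytic_atZSeqCoPRecord_ofThm1TorusClass_ofMinimiserFamily_ofWindowLetters_ofCoercive)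
open Node00 (avOfRecord regMSCoPOfRecord)
open B15Prop1NumericsThresholds (hsm_direct_of_le_explicitThreshold)

variable {F : T4Family}
set_option maxHeartbeats 400000 in
/-- ★★★ **(P2c)″ `(iii)_direct`, EXPLICIT-THRESHOLD FRAME, `hsb`-FREE CHART HALF** — the lane's (P2c)′ (p674082) with its chart-half letter `hhalf` swapped for the ∀-body of dag-n12-c g21's
ρ5c-2 `exists_hWD_chartHalf_of_class_uniform_family` (FIVE constants `C ρ Kτ ρτ ρ5` as binders; the letter reads NO `SmallBelow` — instead the premises `k+1 ≤ m+K`, `4L ≤ M₁`, the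
divisibility, `0 ≤ εreg` and the floor `6(d−1)L·εreg ≤ ρ5`, displayed as rows `hk1 hM4 hεreg hερ`), and the small-below binder `hsb` DROPPED.  Same closed-form threshold `Θ`, same frame
`∀ δ, (∀ i, 0 < δ i) → (∀ i, δ i ≤ Θ i) → ∀ (hσW) (hPχ), ∃ a₁ > 0, Prop1Printed …`.  Proof: (P2c)′'s verbatim with the letter called at the new premises.  (`maxHeartbeats 400000`: as (P2c)′.)
[cite: Balaban1989LargeFieldI, (1.74) p.192, Prop. 1 (1.77)–(1.78) p.194, (1.79) p.195; Balaban1989LargeFieldII, p.357, (1.7)–(1.9) p.358, (1.12)–(1.13) p.359; Balaban1985Variational, (2)–(4) p.278, Thm 1 (8) p.279, (44)–(48) p.285, (81)–(83) p.290; Balaban1988Convergent, (2.2) p.255, (2.11)–(2.14) pp.256–257] -/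
theorem exists_domain_prop1Printed_lfVarOn_std_su2_box_intrinsic_analytic_atZSeqCoPRecord_ofThm1TorusClass_ofMinimiserFamily_ofWindowGaugeLetter_ofChartHalfOfClass_explicit
    (ν : Node00.Stage7Numerics) (Kt : ℕ) (hd3 : 3 ≤ (F.P Kt).d) (h0 : 0 < (F.P Kt).d) {ι : Type}
    (Z Λ : ι → Set (Site (F.P Kt) 0)) (k : ι → ℕ) (M : ι → ℝ) (hk0 : ∀ i, 0 < k i) (hk1 : ∀ i, k i + 1 ≤ (F.P Kt).m + (F.P Kt).K)
    (eR : ι → ℝ) (heR : ∀ i, 0 < eR i)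
    (T : ∀ i, Finset (PBond (F.P Kt) (k i)))
    (lo hi : ι → Fin (F.P Kt).d → ℤ) (n : ι → ℕ) (hn : ∀ i κ, hi i κ ≤ lo i κ + n i) (hN : ∀ i, n i + 2 < (F.P Kt).sitesPerDir (k i))
    (hbox : ∀ i, pts (k i) (Λ i) = (castSite '' Set.Icc (lo i) (hi i) : Set (Site (F.P Kt) (k i))))
    (hZ : ∀ i, (boxPlaqs (lo i - 1) (hi i + 1) : Set (Plaq (F.P Kt) (k i))) ⊆ plaqsInside (pts (k i) (Z i)))
    (hTG0 : ∀ i, T i = (box (fun κ => (hi i κ - lo i κ + 1).toNat) (lo i)).image fun x =>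
      (⟨castSite (x - unitVec ⟨0, h0⟩), ⟨0, h0⟩⟩ : PBond (F.P Kt) (k i)))
    (hN5 : ∀ i κ, ((hi i κ - lo i κ + 1).toNat : ℤ) + 5 < (F.P Kt).sitesPerDir (k i))
    (K : ι → ℕ) (hK1 : ∀ i, 1 ≤ K i) (hKn : ∀ i κ, (hi i κ - lo i κ + 1).toNat ≤ K i)
    (ext : ∀ i, GaugeField (F.P Kt) (k i) SU2 → GaugeField (F.P Kt) (k i) SU2)
    (hext : ∀ i Vk, ext i Vk = extend (pts (k i) (Λ i)) (shellGauge Vk (lo i) (hi i)) Vk)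
    (hlohi : ∀ i, lo i ≤ hi i)
    -- the REGION parallelepipeds of the normalisation and the datum tolerances
    (LO HI : ι → Fin (F.P Kt).d → ℤ) (hLO : ∀ i, LO i ≤ lo i - 1) (hHI : ∀ i, hi i + 1 ≤ HI i) (n' : ι → ℕ) (hn' : ∀ i κ, HI i κ ≤ LO i κ + n' i)
    (hn'N : ∀ i, n' i < (F.P Kt).sitesPerDir (k i)) (hR' : ∀ i, (boxPlaqs (LO i) (HI i) : Set (Plaq (F.P Kt) (k i))) ⊆ plaqsInside (pts (k i) (Z i)))
    (ρn : ι → ℝ)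
    (hρn : ∀ i, (((F.P Kt).d : ℝ) * n' i + 1) * ((((F.P Kt).d - 1 : ℕ) : ℝ) * n' i * ((12 * (F.P Kt).d * (n i + 2) ^ 2 + 1) * eR i)
      + 3 * (F.P Kt).d * (n i + 2) ^ 2 * eR i) ≤ ρn i)
    {γ cJ bx : ℝ} (hγ : 0 < γ) (hcJ : 0 ≤ cJ) (hbx : 0 ≤ bx)
    (hbxM : ∀ i, 12 * ((F.P Kt).d : ℝ) * ((n i : ℝ) + 2) ^ 2 ≤ bx * (M i) ^ 2)
    {R 𝓐₀ : ι → ℝ} (hM : ∀ i, 1 ≤ (M i)) (hR : ∀ i, 0 < R i) (h𝓐₀ : ∀ i, 0 ≤ 𝓐₀ i)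
    -- (J0′), R-EXPLICIT: per instance one radius and one bound for every base field of the strict guard
    (hMin : ∀ i Vk, PlaqSmallOn (plaqsInside (pts (k i) (Z i ∩ (Λ i)ᶜ))) (eR i) Vk →
      ∃ Ũ : VecField (F.P Kt) (k i) (EuclideanSpace ℂ (Fin 3)) × VecField (F.P Kt) (k i) (EuclideanSpace ℂ (Fin 3)) →
          PBond (F.P Kt) 0 → Matrix (Fin 2) (Fin 2) ℂ,
        (∀ b a c, DifferentiableOn ℂ (fun z => Ũ z b a c) (ball 0 (R i))) ∧
        (∀ z ∈ ball (0 : VecField (F.P Kt) (k i) (EuclideanSpace ℂ (Fin 3)) × VecField (F.P Kt) (k i) (EuclideanSpace ℂ (Fin 3))) (R i),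
          ∀ b a c, ‖Ũ z b a c‖ ≤ 𝓐₀ i) ∧
        ∀ p B' : VecField (F.P Kt) (k i) E3, ‖p‖ < R i → ‖B'‖ < R i → ∃ U' : GaugeField (F.P Kt) 0 SU2,
          (∀ b, Ũ (cplxVec p, cplxVec B') b = ((U' b : SU2) : Matrix (Fin 2) (Fin 2) ℂ)) ∧
            IsMinimizer (Node00.avOfRecord F 2 Kt) (Node00.regMSCoPOfRecord F 2 ν Kt (k i) (maxDomT ν.M₁ (Z i))) (Bj ν.M₁ (Z i) (k i))
              (avgFamily (Node00.avOfRecord F 2 Kt) (qsstarGIter0 (k i) (expMul su2Chart B' (ext i (expMul su2Chart p Vk))))) U')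
    -- dag-n12-w4's GEOMETRY letter of the chart file (the window box and its two shifts inside `Ω_k(Z)`)
    (hΩw : ∀ i, ∀ (ν' : Fin (F.P Kt).d), ∀ z ∈ box (fun κ => (hi i κ - lo i κ + 1).toNat + 3) (fun κ => lo i κ - 2),
      (castSite z : Site (F.P Kt) (k i)) ∈ pts (k i) (maxDomT ν.M₁ (Z i) (k i)) ∧
        (castSite z : Site (F.P Kt) (k i)).shift ⟨0, h0⟩ ∈ pts (k i) (maxDomT ν.M₁ (Z i) (k i)) ∧
        (castSite z : Site (F.P Kt) (k i)).shift ν' ∈ pts (k i) (maxDomT ν.M₁ (Z i) (k i)))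
    -- the WINDOW per instance, containing every plaquette whose source lies in the fine image of the enlarged window box (the chart half's `hW`)
    (W : ι → Finset (Plaq (F.P Kt) 0))
    (hWbox : ∀ i, ∀ q : Plaq (F.P Kt) 0, q.src ∈ ((box (fun κ => (F.P Kt).L ^ (k i) * ((hi i κ - lo i κ + 1).toNat + 3 + 1) - 1) (fun κ => ((F.P Kt).L : ℤ) ^ (k i) * (lo i κ - 2))).image
        (fun z => (castSite z : Site (F.P Kt) 0))) → q ∈ W i)
    -- THE CHART HALF, DISPLAYED and `hsb`-FREE (LOCATED-FLOOR + LOCATED-HSB): its FIVE per-height constants as BINDERS and ONE letter = the ∀-body of dag-n12-c g21's ρ5c-2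
    -- `N12DirectChartPackageOfClassFamily.exists_hWD_chartHalf_of_class_uniform_family` at height `k i` (NO `SmallBelow` premise; `ν Z Λ T lo hi` quantified inside; `choose` over ρ5c-2 discharges it)
    (C ρ Kτ ρτ ρ5 : ι → ℝ) (hρ : ∀ i, 0 < ρ i) (hKτ : ∀ i, 0 ≤ Kτ i) (hρτ : ∀ i, 0 < ρτ i)
    (hhalf : ∀ i,
        ∀ (ν : Node00.Stage7Numerics) (Z Λ : Set (Site (F.P Kt) 0)) (T : Finset (PBond (F.P Kt) (k i))) (lo hi : Fin (F.P Kt).d → ℤ),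
        (∀ κ, ((((hi κ - lo κ + 1).toNat + 3 : ℕ) : ℤ)) ≤ (F.P Kt).sitesPerDir (k i)) →
        (∀ (ν' : Fin (F.P Kt).d), ∀ z ∈ box (fun κ => (hi κ - lo κ + 1).toNat + 3) (fun κ => lo κ - 2),
          (castSite z : Site (F.P Kt) (k i)) ∈ pts (k i) (maxDomT ν.M₁ Z (k i)) ∧ (castSite z : Site (F.P Kt) (k i)).shift ⟨0, h0⟩ ∈ pts (k i) (maxDomT ν.M₁ Z (k i)) ∧
            (castSite z : Site (F.P Kt) (k i)).shift ν' ∈ pts (k i) (maxDomT ν.M₁ Z (k i))) →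
        (k i) + 1 ≤ (F.P Kt).m + (F.P Kt).K → 4 * (F.P Kt).L ≤ ν.M₁ → side (F.P Kt).L ν.M₁ (k i) ∣ (F.P Kt).sitesPerDir 0 → 0 ≤ ν.εreg →
        6 * ((((F.P Kt).d - 1 : ℕ)) : ℝ) * (F.P Kt).L * ν.εreg ≤ ρ5 i →
        ∀ (ext : GaugeField (F.P Kt) (k i) SU2 → GaugeField (F.P Kt) (k i) SU2) (Vk : GaugeField (F.P Kt) (k i) SU2) ⦃R 𝓐₀ : ℝ⦄, 0 < R → 0 ≤ 𝓐₀ →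
        ∀ (U₀ : GaugeField (F.P Kt) 0 SU2) (Xf : GaugeSlice (pts (k i) Λ) T E3 → PBond (F.P Kt) 0 → lieSU (Fin 2)),
        IsMinimizer (Node00.avOfRecord F 2 Kt) (Node00.regMSCoPOfRecord F 2 ν Kt (k i) (maxDomT ν.M₁ Z)) (Bj ν.M₁ Z (k i))
          (avgFamily (Node00.avOfRecord F 2 Kt) (qsstarGIter0 (k i) (ext Vk))) U₀ →
        ∀ ⦃εP : ℝ⦄, 0 ≤ εP →
        (∀ p : Plaq (F.P Kt) 0, ((⟨p.src, p.μ⟩ : PBond (F.P Kt) 0) ∈ {b : PBond (F.P Kt) 0 | b.src ∈ maxDomT ν.M₁ Z 1} ∨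
            (⟨p.src.shift p.μ, p.ν⟩ : PBond (F.P Kt) 0) ∈ {b : PBond (F.P Kt) 0 | b.src ∈ maxDomT ν.M₁ Z 1} ∨
            (⟨p.src.shift p.ν, p.μ⟩ : PBond (F.P Kt) 0) ∈ {b : PBond (F.P Kt) 0 | b.src ∈ maxDomT ν.M₁ Z 1} ∨
            (⟨p.src, p.ν⟩ : PBond (F.P Kt) 0) ∈ {b : PBond (F.P Kt) 0 | b.src ∈ maxDomT ν.M₁ Z 1}) →
          ‖((GaugeField.plaqHol U₀ p : SU2) : Matrix (Fin 2) (Fin 2) ℂ) - 1‖ ≤ εP) →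
        ∀ (H : (Fin (constrCard (Bj ν.M₁ Z (k i)) (k i)) → lieSU (Fin 2)) → PBond (F.P Kt) 0 → lieSU (Fin 2)) ⦃B : ℝ⦄, 0 ≤ B →
        (∀ v, fderiv ℝ (msChart F 2 Kt (k i) (Bj ν.M₁ Z (k i)) (avgFamily (avOfRecord F 2 Kt) (qsstarGIter0 (k i) (ext Vk))) U₀) 0 (H v) = v) →
        (∀ v, Real.sqrt (∑ b, ‖H v b‖ ^ 2) ≤ B * ‖v‖) →
        ∀ ⦃M₂ : ℝ⦄, 0 ≤ M₂ → (∀ w, ‖fderiv ℝ (fderiv ℝ (msChart F 2 Kt (k i) (Bj ν.M₁ Z (k i)) (avgFamily (avOfRecord F 2 Kt) (qsstarGIter0 (k i) (ext Vk))) U₀)) 0 w w‖ ≤ M₂ * ‖w‖ ^ 2) →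
        Xf 0 = 0 → ContDiffAt ℝ 2 Xf 0 →
        (∀ᶠ Y in 𝓝 (0 : GaugeSlice (pts (k i) Λ) T E3),
          IsMinimizer (Node00.avOfRecord F 2 Kt) (Node00.regMSCoPOfRecord F 2 ν Kt (k i) (maxDomT ν.M₁ Z)) (Bj ν.M₁ Z (k i))
            (avgFamily (Node00.avOfRecord F 2 Kt) (qsstarGIter0 (k i) (expMul su2Chart (ιA (pts (k i) Λ) T Y) (ext Vk)))) (expChart U₀ (Xf Y))) →
        (∀ (X : GaugeSlice (pts (k i) Λ) T E3) (b : PBond (F.P Kt) 0),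
          ‖((fderiv ℝ Xf 0 X b : lieSU (Fin 2)) : Matrix (Fin 2) (Fin 2) ℂ)‖ ≤ 8 * 𝓐₀ / R * ‖X‖ ∧ ‖fderiv ℝ Xf 0 X b‖ ≤ 12 * 𝓐₀ / R * ‖X‖) →
        (∀ (X : GaugeSlice (pts (k i) Λ) T E3) (b : PBond (F.P Kt) 0), b.src ∉ maxDomT ν.M₁ Z 1 → fderiv ℝ Xf 0 X b = 0) →
        ∀ (W : Finset (Plaq (F.P Kt) 0)),
        (∀ q : Plaq (F.P Kt) 0, q.src ∈ ((box (fun κ => (F.P Kt).L ^ (k i) * ((hi κ - lo κ + 1).toNat + 3 + 1) - 1) (fun κ => ((F.P Kt).L : ℤ) ^ (k i) * (lo κ - 2))).image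
            (fun z => (castSite z : Site (F.P Kt) 0))) → q ∈ W) →
        ∀ ⦃δW : ℝ⦄, 0 < δW → δW < ρ i → δW < ρτ i →
        (∀ (ν' : Fin (F.P Kt).d), ∀ z ∈ box (fun κ => (hi κ - lo κ + 1).toNat + 3) (fun κ => lo κ - 2), ∀ b₀ : PBond (F.P Kt) 0,
          (b₀ ∈ feeds (k i) (⟨(castSite z : Site (F.P Kt) (k i)), ⟨0, h0⟩⟩ : PBond (F.P Kt) (k i)) ∨ b₀ ∈ feeds (k i) (⟨((castSite z : Site (F.P Kt) (k i))).shift ⟨0, h0⟩, ν'⟩ : PBond (F.P Kt) (k i))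
          ∨ b₀ ∈ feeds (k i) (⟨((castSite z : Site (F.P Kt) (k i))).shift ν', ⟨0, h0⟩⟩ : PBond (F.P Kt) (k i)) ∨ b₀ ∈ feeds (k i) (⟨(castSite z : Site (F.P Kt) (k i)), ν'⟩ : PBond (F.P Kt) (k i))) →
          ‖((U₀ b₀ : SU2) : Matrix (Fin 2) (Fin 2) ℂ) - 1‖ ≤ δW) →
        ∃ (Ψ₂ : (PBond (F.P Kt) 0 → lieSU (Fin 2)) →L[ℝ] (PBond (F.P Kt) 0 → lieSU (Fin 2)) →L[ℝ] (Fin (constrCard (Bj ν.M₁ Z (k i)) (k i)) → lieSU (Fin 2)))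
          (lam : (Fin (constrCard (Bj ν.M₁ Z (k i)) (k i)) → lieSU (Fin 2)) →L[ℝ] ℝ)
          (p : Seminorm ℝ (PBond (F.P Kt) 0 → lieSU (Fin 2))),
          HasFDerivAt (fun Y => fderiv ℝ (msChart F 2 Kt (k i) (Bj ν.M₁ Z (k i)) (avgFamily (avOfRecord F 2 Kt) (qsstarGIter0 (k i) (ext Vk))) U₀) Y) Ψ₂ 0 ∧
          (∀ᶠ Y in 𝓝 (0 : PBond (F.P Kt) 0 → lieSU (Fin 2)), DifferentiableAt ℝ (msChart F 2 Kt (k i) (Bj ν.M₁ Z (k i)) (avgFamily (avOfRecord F 2 Kt) (qsstarGIter0 (k i) (ext Vk))) U₀) Y) ∧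
          fderiv ℝ (fun Y : PBond (F.P Kt) 0 → lieSU (Fin 2) => wilsonAction4 (expChart U₀ Y)) 0 = lam.comp (fderiv ℝ (msChart F 2 Kt (k i) (Bj ν.M₁ Z (k i)) (avgFamily (avOfRecord F 2 Kt) (qsstarGIter0 (k i) (ext Vk))) U₀) 0) ∧
          (∀ Y : PBond (F.P Kt) 0 → lieSU (Fin 2), ∑ b, ‖(Y b : Matrix (Fin 2) (Fin 2) ℂ)‖ ^ 2 ≤ p Y ^ 2) ∧
          ∀ X : GaugeSlice (pts (k i) Λ) T E3,
            lam (Ψ₂ (fderiv ℝ Xf 0 X) (fderiv ℝ Xf 0 X))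
                ≤ (2 * (((F.P Kt).d : ℝ) - 1) * εP * Real.sqrt (Fintype.card (PBond (F.P Kt) 0)) * B * M₂) * p (fderiv ℝ Xf 0 X) ^ 2 ∧
            p (fderiv ℝ Xf 0 X) ≤ (12 * 𝓐₀ / R * Real.sqrt (Nat.card {b : PBond (F.P Kt) 0 // b.src ∈ maxDomT ν.M₁ Z 1})) * ‖X‖ ∧
            (((F.P Kt).L : ℝ) ^ (F.P Kt).d) ^ (k i) / ((((F.P Kt).L : ℝ)) ^ 2 * ((F.P Kt).L : ℝ) ^ 2) ^ (k i) / 2 * (∑ z ∈ box (fun κ => (hi κ - lo κ + 1).toNat + 3) (fun κ => lo κ - 2), ∑ μ : Fin (F.P Kt).d, ∑ a : Fin 3, curl (fun b => ιA (pts (k i) Λ) T X (⟨castSite b.1, b.2⟩ : PBond (F.P Kt) (k i)) a) z ⟨0, h0⟩ μ ^ 2)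
                - (((F.P Kt).L : ℝ) ^ (F.P Kt).d) ^ (k i) / ((((F.P Kt).L : ℝ)) ^ 2 * ((F.P Kt).L : ℝ) ^ 2) ^ (k i) * (8 * (((F.P Kt).d : ℝ) + 1) * (2 * ((Kτ i) + 1) * δW) + 8 * ((F.P Kt).d : ℝ) * (((box (fun κ => (hi κ - lo κ + 1).toNat + 3) (fun κ => lo κ - 2)).image (fun z => (castSite z : Site (F.P Kt) (k i)))).card : ℝ) * ((C i) * δW * (12 * 𝓐₀ / R * Real.sqrt (Nat.card {b : PBond (F.P Kt) 0 // b.src ∈ maxDomT ν.M₁ Z 1}))) ^ 2) * ‖X‖ ^ 2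
              ≤ ((Fintype.card (Fin 2) : ℝ)⁻¹ • ∑ p ∈ W, (innerSL ℝ (E := lieSU (Fin 2))).bilinearComp
                (ContinuousLinearMap.proj (R := ℝ) (φ := fun _ : PBond (F.P Kt) 0 => lieSU (Fin 2)) (⟨p.src, p.μ⟩ : PBond (F.P Kt) 0) + ContinuousLinearMap.proj (R := ℝ) (φ := fun _ : PBond (F.P Kt) 0 => lieSU (Fin 2)) (⟨p.src.shift p.μ, p.ν⟩ : PBond (F.P Kt) 0)
                  - ContinuousLinearMap.proj (R := ℝ) (φ := fun _ : PBond (F.P Kt) 0 => lieSU (Fin 2)) (⟨p.src.shift p.ν, p.μ⟩ : PBond (F.P Kt) 0) - ContinuousLinearMap.proj (R := ℝ) (φ := fun _ : PBond (F.P Kt) 0 => lieSU (Fin 2)) (⟨p.src, p.ν⟩ : PBond (F.P Kt) 0) : (PBond (F.P Kt) 0 → lieSU (Fin 2)) →L[ℝ] lieSU (Fin 2))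
                (ContinuousLinearMap.proj (R := ℝ) (φ := fun _ : PBond (F.P Kt) 0 => lieSU (Fin 2)) (⟨p.src, p.μ⟩ : PBond (F.P Kt) 0) + ContinuousLinearMap.proj (R := ℝ) (φ := fun _ : PBond (F.P Kt) 0 => lieSU (Fin 2)) (⟨p.src.shift p.μ, p.ν⟩ : PBond (F.P Kt) 0)
                  - ContinuousLinearMap.proj (R := ℝ) (φ := fun _ : PBond (F.P Kt) 0 => lieSU (Fin 2)) (⟨p.src.shift p.ν, p.μ⟩ : PBond (F.P Kt) 0) - ContinuousLinearMap.proj (R := ℝ) (φ := fun _ : PBond (F.P Kt) 0 => lieSU (Fin 2)) (⟨p.src, p.ν⟩ : PBond (F.P Kt) 0) : (PBond (F.P Kt) 0 → lieSU (Fin 2)) →L[ℝ] lieSU (Fin 2))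
                : (PBond (F.P Kt) 0 → lieSU (Fin 2)) →L[ℝ] (PBond (F.P Kt) 0 → lieSU (Fin 2)) →L[ℝ] ℝ) (fderiv ℝ Xf 0 X) (fderiv ℝ Xf 0 X))
    -- the `hsb`-free letter's numeric premises displayed: radius row, the class threshold positive, and its floor against the per-height curvature radius `ρ5`
    (hM4 : 4 * (F.P Kt).L ≤ ν.M₁) (hεreg : 0 < ν.εreg) (hερ : ∀ i, 6 * ((((F.P Kt).d - 1 : ℕ)) : ℝ) * (F.P Kt).L * ν.εreg ≤ ρ5 i)
    -- the (P4)′ constant and the chart-curvature constant (P5), per instance, chosen BEFORE the base field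
    (B M₂ : ι → ℝ) (hB0 : ∀ i, 0 ≤ B i) (hM₂0 : ∀ i, 0 ≤ M₂ i)
    -- DISPLAYED per guarded base field ∕ minimiser: the (P4)′ socket (`hsurj` + uniform bound, LOCATED-P4-LETTER) and the chart-curvature letter (P5) — the small-below letter `hsb` is
    -- GONE from this file (it fed only the chart half; it survives downstream as a premise of the (P4)′∕(P5) letters until their proxy editions land)
    (hH : ∀ i (Vk : GaugeField (F.P Kt) (k i) SU2), PlaqSmallOn (plaqsInside (pts (k i) (Z i ∩ (Λ i)ᶜ))) (eR i) Vk →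
      (∀ b ∈ (boxBonds (LO i) (HI i) : Set (PBond (F.P Kt) (k i))), dist1 (ext i Vk b) ≤ ρn i) →
      ∀ U₀ : GaugeField (F.P Kt) 0 SU2,
        IsMinimizer (Node00.avOfRecord F 2 Kt) (Node00.regMSCoPOfRecord F 2 ν Kt (k i) (maxDomT ν.M₁ (Z i))) (Bj ν.M₁ (Z i) (k i))
          (avgFamily (Node00.avOfRecord F 2 Kt) (qsstarGIter0 (k i) (ext i Vk))) U₀ →
        ∃ H : (Fin (constrCard (Bj ν.M₁ (Z i) (k i)) (k i)) → lieSU (Fin 2)) → PBond (F.P Kt) 0 → lieSU (Fin 2),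
          (∀ v, fderiv ℝ (msChart F 2 Kt (k i) (Bj ν.M₁ (Z i) (k i)) (avgFamily (Node00.avOfRecord F 2 Kt) (qsstarGIter0 (k i) (ext i Vk))) U₀) 0 (H v) = v) ∧
          (∀ v, Real.sqrt (∑ b, ‖H v b‖ ^ 2) ≤ B i * ‖v‖))
    (hM₂ : ∀ i (Vk : GaugeField (F.P Kt) (k i) SU2), PlaqSmallOn (plaqsInside (pts (k i) (Z i ∩ (Λ i)ᶜ))) (eR i) Vk →
      (∀ b ∈ (boxBonds (LO i) (HI i) : Set (PBond (F.P Kt) (k i))), dist1 (ext i Vk b) ≤ ρn i) →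
      ∀ U₀ : GaugeField (F.P Kt) 0 SU2,
        IsMinimizer (Node00.avOfRecord F 2 Kt) (Node00.regMSCoPOfRecord F 2 ν Kt (k i) (maxDomT ν.M₁ (Z i))) (Bj ν.M₁ (Z i) (k i))
          (avgFamily (Node00.avOfRecord F 2 Kt) (qsstarGIter0 (k i) (ext i Vk))) U₀ →
        ∀ w, ‖fderiv ℝ (fderiv ℝ (msChart F 2 Kt (k i) (Bj ν.M₁ (Z i) (k i)) (avgFamily (Node00.avOfRecord F 2 Kt) (qsstarGIter0 (k i) (ext i Vk))) U₀)) 0 w w‖ ≤ M₂ i * ‖w‖ ^ 2)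
    -- numerics: the positivity constant fits (`γ₀ := 1∕2`: the chart half's level factor `((L^d)^k∕(L²·L²)^k)∕2` at `d = 4`)
    (hγle : ∀ i, γ / (M i) ^ 5 ≤ 1 / 2 / (2 * (3 * (K i : ℝ) ^ 2 + 2 * (K i : ℝ) ^ 4)))
    (hfar : ∀ i (b : PBond (F.P Kt) 0), b.src ∉ maxDomT ν.M₁ (Z i) 1 →
      (⟨blockIter (k i) b.src, b.dir⟩ : PBond (F.P Kt) (k i)) ∉ bondsOf (pts (k i) (Λ i)))
    (hZblk : ∀ i, IsBlockUnion (k i) (Z i))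
    (hM2 : 2 ≤ ν.M₁) (hdiv : ∀ i, side (F.P Kt).L ν.M₁ (k i) ∣ (F.P Kt).sitesPerDir 0)
    {cE B₃ a₀ a₁' cA : ℝ} (hcE0 : 0 ≤ cE) (hcE : ∀ i, 12 * ((F.P Kt).d : ℝ) * ((n i : ℝ) + 2) ^ 2 ≤ cE) (hB₃ : 0 ≤ B₃)
    (heRa : ∀ i, (cE + 1) * eR i ≤ a₁' ∧ B₃ * ((cE + 1) * eR i) ≤ ν.εreg) (ha₀ : ν.εreg ≤ a₀)
    (hcA : 1 / 2 * (B₃ * (cE + 1) * (F.P Kt).eta 1 ^ 2) ^ 2 * (Fintype.card (Plaq (F.P Kt) 0) : ℝ) ≤ cA)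
    (h15T : ∀ (k' : ℕ), k' ≤ (F.P Kt).m + (F.P Kt).K → side (F.P Kt).L ν.M₁ k' ∣ (F.P Kt).sitesPerDir 0 →
      ∀ (s : B14.Eq218Concrete.Seq (fun n : ℕ => Node00.unionsOfCubes (F.P Kt) (side (F.P Kt).L ν.M₁ n)) k'),
      Node00.Sect2.SeqSeparated ν.M₁ s → 0 < ν.M₁ →
      ∀ (ε₀ : ℝ) (δ : ℕ → ℝ), (∀ j, j ≤ k' → 0 < δ j ∧ δ j ≤ a₁' ∧ B₃ * δ j ≤ ε₀) → (∀ j, j < k' → δ j ≤ 2 * δ (j + 1)) →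
      (∀ j, j < k' → δ (j + 1) ≤ 2 * δ j) → ε₀ ≤ a₀ →
      ∀ W : MSField (F.P Kt) SU2,
        Node00.Sect2.DataSmall7PTop (Node00.avOfRecord F 2 Kt) s.Ω (Node00.suppDomOfRecord F ν Kt s.Ω) k' δ W →
        ∀ U₀ : GaugeField (F.P Kt) 0 SU2, IsMinimizer (Node00.avOfRecord F 2 Kt)
            {U | (∀ j, j ≤ k' → PlaqSmallOn (Node00.Sect2.omegaPlaqsTop s.Ω (Node00.suppDomOfRecord F ν Kt s.Ω) j)
                (ε₀ * (F.P Kt).eta j ^ 2) U) ∧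
              Node00.Sect2.CoDivClassOnTop s.Ω (Node00.suppDomOfRecord F ν Kt s.Ω) k' ε₀ U}
            (genSet s.Ω k') W U₀ →
          (∀ j, j ≤ k' → PlaqSmallOn (Node00.Sect2.omegaPlaqsTop s.Ω (Node00.suppDomOfRecord F ν Kt s.Ω) j)
              (B₃ * δ j * (F.P Kt).eta j ^ 2) U₀) ∧
            ∀ j, j ≤ k' → Node00.Sect2.CoDivSmallOn (Node00.Sect2.omegaBondsTop s.Ω (Node00.suppDomOfRecord F ν Kt s.Ω) j)
              (B₃ * δ j * (F.P Kt).eta j ^ 3) U₀)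
    (hcJ' : ∀ i, 2 * cA * eR i / R i + 4 * ((Fintype.card (Plaq (F.P Kt) 0) : ℝ) * (1 + 8 * 𝓐₀ i ^ 4)) / (R i * eR i) ≤ cJ)
    -- THE EXPLICIT-THRESHOLD FRAME (no `∃ δ₀`): tolerances below `Θ i := min (min (ρ i) (ρτ i) ∕ 2) (min 1 (rhs_i ∕ (max S_i 0 + 1)))`, every symbol a binder or a cardinality
    : ∀ δ : ι → ℝ, (∀ i, 0 < δ i) →
      (∀ i, δ i ≤ min (min (ρ i) (ρτ i) / 2)
        (min 1 (1 / 2 / (2 * (3 * (K i : ℝ) ^ 2 + 2 * (K i : ℝ) ^ 4)) /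
          (max ((32 * (((F.P Kt).d : ℝ) - 1) + 8 * (((F.P Kt).d : ℝ) - 1) + (2 * (((F.P Kt).d : ℝ) - 1) * Real.sqrt (Fintype.card (PBond (F.P Kt) 0)) * B i * M₂ i)) * (12 * 𝓐₀ i / R i * Real.sqrt (Nat.card {b : PBond (F.P Kt) 0 // b.src ∈ maxDomT ν.M₁ (Z i) 1})) ^ 2
            + (8 * (((F.P Kt).d : ℝ) + 1) * (2 * (Kτ i + 1)) + 8 * ((F.P Kt).d : ℝ) * (((box (fun κ => (hi i κ - lo i κ + 1).toNat + 3) (fun κ => lo i κ - 2)).image (fun z => (castSite z : Site (F.P Kt) (k i)))).card : ℝ) * (C i * (12 * 𝓐₀ i / R i * Real.sqrt (Nat.card {b : PBond (F.P Kt) 0 // b.src ∈ maxDomT ν.M₁ (Z i) 1}))) ^ 2)) 0 + 1)))) →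
      -- (σ)_W THE WINDOW GAUGE LETTER at tolerance `δ i` on the window's plaquette bonds and on the feeds (dag-n12-c's §2 text at `δc = δW := δ i`)
      ∀ (hσW : ∀ i (Vk : GaugeField (F.P Kt) (k i) SU2), PlaqSmallOn (plaqsInside (pts (k i) (Z i ∩ (Λ i)ᶜ))) (eR i) Vk →
      (∀ b ∈ (boxBonds (LO i) (HI i) : Set (PBond (F.P Kt) (k i))), dist1 (ext i Vk b) ≤ ρn i) →
      ∀ U₀ : GaugeField (F.P Kt) 0 SU2,
        IsMinimizer (Node00.avOfRecord F 2 Kt) (Node00.regMSCoPOfRecord F 2 ν Kt (k i) (maxDomT ν.M₁ (Z i))) (Bj ν.M₁ (Z i) (k i))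
          (avgFamily (Node00.avOfRecord F 2 Kt) (qsstarGIter0 (k i) (ext i Vk))) U₀ →
        ∃ σ : GaugeTransf (F.P Kt) 0 SU2,
          (∀ j, j ≤ k i → ∀ b ∈ bondsOf (Bj ν.M₁ (Z i) (k i) j), toMS σ j b.src = 1 ∧ toMS σ j b.tgt = 1) ∧
          (∀ p ∈ W i, ‖((gaugeAct σ U₀ ⟨p.src, p.μ⟩ : SU2) : Matrix (Fin 2) (Fin 2) ℂ) - 1‖ ≤ δ i ∧ ‖((gaugeAct σ U₀ ⟨p.src.shift p.μ, p.ν⟩ : SU2) : Matrix (Fin 2) (Fin 2) ℂ) - 1‖ ≤ δ i ∧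
            ‖((gaugeAct σ U₀ ⟨p.src.shift p.ν, p.μ⟩ : SU2) : Matrix (Fin 2) (Fin 2) ℂ) - 1‖ ≤ δ i ∧ ‖((gaugeAct σ U₀ ⟨p.src, p.ν⟩ : SU2) : Matrix (Fin 2) (Fin 2) ℂ) - 1‖ ≤ δ i) ∧
          (∀ (ν' : Fin (F.P Kt).d), ∀ z ∈ box (fun κ => (hi i κ - lo i κ + 1).toNat + 3) (fun κ => lo i κ - 2), ∀ b₀ : PBond (F.P Kt) 0,
            (b₀ ∈ feeds (k i) (⟨(castSite z : Site (F.P Kt) (k i)), ⟨0, h0⟩⟩ : PBond (F.P Kt) (k i)) ∨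
              b₀ ∈ feeds (k i) (⟨((castSite z : Site (F.P Kt) (k i))).shift ⟨0, h0⟩, ν'⟩ : PBond (F.P Kt) (k i)) ∨
              b₀ ∈ feeds (k i) (⟨((castSite z : Site (F.P Kt) (k i))).shift ν', ⟨0, h0⟩⟩ : PBond (F.P Kt) (k i)) ∨
              b₀ ∈ feeds (k i) (⟨(castSite z : Site (F.P Kt) (k i)), ν'⟩ : PBond (F.P Kt) (k i))) →
            ‖((gaugeAct σ U₀ b₀ : SU2) : Matrix (Fin 2) (Fin 2) ℂ) - 1‖ ≤ δ i))
      -- THE PLAQUETTE LETTER at tolerance `δ i`: every (2.12) minimiser of the guarded datum is `δ i`-plaquette-small on the plaquettes with a bond starting in `Ω₁(Z_i)` (P1 and the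
      -- chart half's (μ)-row input; the class ∕ [15] Thm 1 (8) reading)
      (hPχ : ∀ i (Vk : GaugeField (F.P Kt) (k i) SU2), PlaqSmallOn (plaqsInside (pts (k i) (Z i ∩ (Λ i)ᶜ))) (eR i) Vk →
      (∀ b ∈ (boxBonds (LO i) (HI i) : Set (PBond (F.P Kt) (k i))), dist1 (ext i Vk b) ≤ ρn i) →
      ∀ U₀ : GaugeField (F.P Kt) 0 SU2,
        IsMinimizer (Node00.avOfRecord F 2 Kt) (Node00.regMSCoPOfRecord F 2 ν Kt (k i) (maxDomT ν.M₁ (Z i))) (Bj ν.M₁ (Z i) (k i))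
          (avgFamily (Node00.avOfRecord F 2 Kt) (qsstarGIter0 (k i) (ext i Vk))) U₀ →
        ∀ p : Plaq (F.P Kt) 0, ((⟨p.src, p.μ⟩ : PBond (F.P Kt) 0) ∈ {b : PBond (F.P Kt) 0 | b.src ∈ maxDomT ν.M₁ (Z i) 1} ∨
            (⟨p.src.shift p.μ, p.ν⟩ : PBond (F.P Kt) 0) ∈ {b : PBond (F.P Kt) 0 | b.src ∈ maxDomT ν.M₁ (Z i) 1} ∨
            (⟨p.src.shift p.ν, p.μ⟩ : PBond (F.P Kt) 0) ∈ {b : PBond (F.P Kt) 0 | b.src ∈ maxDomT ν.M₁ (Z i) 1} ∨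
            (⟨p.src, p.ν⟩ : PBond (F.P Kt) 0) ∈ {b : PBond (F.P Kt) 0 | b.src ∈ maxDomT ν.M₁ (Z i) 1}) →
          ‖((GaugeField.plaqHol U₀ p : SU2) : Matrix (Fin 2) (Fin 2) ℂ) - 1‖ ≤ δ i),
      ∃ a₁ : ι → ℝ, (∀ i, 0 < a₁ i) ∧
      B15.Prop1Printed (lfVarOn su2Chart fun i =>
        InstOn.std (Node00.bgMSCoPOfRecord F 2 ν Kt (k i) (maxDomT ν.M₁ (Z i))) ν.M₁ (Z i) (Λ i) (k i) (M i) (a₁ i)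
          (anExt (pts (k i) (Λ i)) (T i)
            (fun177std (Node00.bgMSCoPOfRecord F 2 ν Kt (k i) (maxDomT ν.M₁ (Z i))) ν.M₁ (Z i) (k i)) (ext i)
            (min (1 / 2) (min (R i / 8) (γ / (M i) ^ 5 * (R i / 2) ^ 2 /
              (48 * (4 * ((Fintype.card (Plaq (F.P Kt) 0) : ℝ) * (1 + 8 * 𝓐₀ i ^ 4)) / R i + 1))))))) := by
  classical
  have hk : ∀ i, k i ≤ (F.P Kt).m + (F.P Kt).K := fun i => Nat.le_of_succ_le (hk1 i)
  -- `d = 4`: the chart half's level factor `((L^d)^k ∕ (L²·L²)^k)` is `1`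
  have hL : (0 : ℝ) < ((F.P Kt).L : ℝ) := Nat.cast_pos.mpr (F.P Kt).L_pos
  have hA : ∀ i, (((F.P Kt).L : ℝ) ^ (F.P Kt).d) ^ (k i) / ((((F.P Kt).L : ℝ)) ^ 2 * ((F.P Kt).L : ℝ) ^ 2) ^ (k i) = 1 := by
    intro i
    rw [T4Family.P_d, show (((F.P Kt).L : ℝ)) ^ 2 * ((F.P Kt).L : ℝ) ^ 2 = ((F.P Kt).L : ℝ) ^ 4 by ring]
    exact div_self (pow_ne_zero _ (pow_ne_zero _ hL.ne'))
  have hd1 : 1 ≤ (F.P Kt).d := le_trans (by norm_num) hd3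
  have hd1r : (1 : ℝ) ≤ ((F.P Kt).d : ℝ) := by exact_mod_cast hd1
  -- the enlarged window box fits (from `hN5`)
  have hbox3 : ∀ i κ, ((((hi i κ - lo i κ + 1).toNat + 3 : ℕ) : ℤ)) ≤ (F.P Kt).sitesPerDir (k i) := by
    intro i κ; have := hN5 i κ; push_cast; linarith
  intro δ hδpos hδle hσW hPχ
  have hδρ : ∀ i, δ i < ρ i := fun i => by
    have h := (hδle i).trans (min_le_left _ _); have := min_le_left (ρ i) (ρτ i); have := hρ i; linarith
  have hδρτ : ∀ i, δ i < ρτ i := fun i => by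
    have h := (hδle i).trans (min_le_left _ _); have := min_le_right (ρ i) (ρτ i); have := hρτ i; linarith
  -- below the explicit numerics threshold (`Cε := 1` spelled `… * 1` in `hsm_direct_of_le_explicitThreshold`)
  have hδΘ : ∀ i, δ i ≤ min 1 (1 / 2 / (2 * (3 * (K i : ℝ) ^ 2 + 2 * (K i : ℝ) ^ 4)) /
      (max ((32 * (((F.P Kt).d : ℝ) - 1) + 8 * (((F.P Kt).d : ℝ) - 1) * 1 + (2 * (((F.P Kt).d : ℝ) - 1) * Real.sqrt (Fintype.card (PBond (F.P Kt) 0)) * B i * M₂ i)) * (12 * 𝓐₀ i / R i * Real.sqrt (Nat.card {b : PBond (F.P Kt) 0 // b.src ∈ maxDomT ν.M₁ (Z i) 1})) ^ 2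
        + (8 * (((F.P Kt).d : ℝ) + 1) * (2 * (Kτ i + 1)) + 8 * ((F.P Kt).d : ℝ) * (((box (fun κ => (hi i κ - lo i κ + 1).toNat + 3) (fun κ => lo i κ - 2)).image (fun z => (castSite z : Site (F.P Kt) (k i)))).card : ℝ) * (C i * (12 * 𝓐₀ i / R i * Real.sqrt (Nat.card {b : PBond (F.P Kt) 0 // b.src ∈ maxDomT ν.M₁ (Z i) 1}))) ^ 2)) 0 + 1)) := fun i => by
    rw [mul_one]; exact (hδle i).trans (min_le_right _ _)
  have hδone : ∀ i, δ i ≤ 1 := fun i => (hδΘ i).trans (min_le_left _ _)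
  -- `τ(δ) ≤ Cτ·δ` for `δ ≤ 1`
  have hτ : ∀ i, (8 * (((F.P Kt).d : ℝ) + 1) * (2 * (Kτ i + 1) * δ i) + 8 * ((F.P Kt).d : ℝ) * (((box (fun κ => (hi i κ - lo i κ + 1).toNat + 3) (fun κ => lo i κ - 2)).image (fun z => (castSite z : Site (F.P Kt) (k i)))).card : ℝ) * (C i * δ i * (12 * 𝓐₀ i / R i * Real.sqrt (Nat.card {b : PBond (F.P Kt) 0 // b.src ∈ maxDomT ν.M₁ (Z i) 1}))) ^ 2) ≤ (8 * (((F.P Kt).d : ℝ) + 1) * (2 * (Kτ i + 1)) + 8 * ((F.P Kt).d : ℝ) * (((box (fun κ => (hi i κ - lo i κ + 1).toNat + 3) (fun κ => lo i κ - 2)).image (fun z => (castSite z : Site (F.P Kt) (k i)))).card : ℝ) * (C i * (12 * 𝓐₀ i / R i * Real.sqrt (Nat.card {b : PBond (F.P Kt) 0 // b.src ∈ maxDomT ν.M₁ (Z i) 1}))) ^ 2) * δ i := by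
    intro i
    have hN0 : (0 : ℝ) ≤ (((box (fun κ => (hi i κ - lo i κ + 1).toNat + 3) (fun κ => lo i κ - 2)).image (fun z => (castSite z : Site (F.P Kt) (k i)))).card : ℝ) := by positivity
    have hq : (C i * δ i * (12 * 𝓐₀ i / R i * Real.sqrt (Nat.card {b : PBond (F.P Kt) 0 // b.src ∈ maxDomT ν.M₁ (Z i) 1}))) ^ 2 = (C i * (12 * 𝓐₀ i / R i * Real.sqrt (Nat.card {b : PBond (F.P Kt) 0 // b.src ∈ maxDomT ν.M₁ (Z i) 1}))) ^ 2 * (δ i * δ i) := by ring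
    have h2 : δ i * δ i ≤ δ i := by nlinarith [hδpos i, hδone i]
    have h3 : (0 : ℝ) ≤ 8 * ((F.P Kt).d : ℝ) * (((box (fun κ => (hi i κ - lo i κ + 1).toNat + 3) (fun κ => lo i κ - 2)).image (fun z => (castSite z : Site (F.P Kt) (k i)))).card : ℝ) * (C i * (12 * 𝓐₀ i / R i * Real.sqrt (Nat.card {b : PBond (F.P Kt) 0 // b.src ∈ maxDomT ν.M₁ (Z i) 1}))) ^ 2 := by positivity
    have h4 : (0 : ℝ) ≤ 8 * (((F.P Kt).d : ℝ) + 1) * (2 * (Kτ i + 1)) := by have := hKτ i; positivity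
    rw [hq]; nlinarith [h3, h4, h2, (hδpos i).le]
  have hd1' : (0 : ℝ) ≤ ((F.P Kt).d : ℝ) - 1 := by linarith
  have hμc0 : ∀ i, 0 ≤ 2 * (((F.P Kt).d : ℝ) - 1) * δ i * Real.sqrt (Fintype.card (PBond (F.P Kt) 0)) * B i * M₂ i := fun i => by
    have h1 := hB0 i; have h2 := hM₂0 i; have h3 := (hδpos i).le; positivity
  refine exists_domain_prop1Printed_lfVarOn_std_su2_box_intrinsic_analytic_atZSeqCoPRecord_ofThm1TorusClass_ofMinimiserFamily_ofWindowLetters_ofCoercive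
    ν Kt hd3 h0 Z Λ k M hk0 hk eR heR T lo hi n hn hN hbox hZ hTG0 hN5 K hK1 hKn ext hext hlohi LO HI hLO hHI n' hn' hn'N hR' ρn hρn hγ hcJ hbx hbxM hM hR hMin
    (γ₀ := 1 / 2) (by norm_num) W
    (δc := δ) (εc := δ) (δW := δ) (μc := fun i => 2 * (((F.P Kt).d : ℝ) - 1) * δ i * Real.sqrt (Fintype.card (PBond (F.P Kt) 0)) * B i * M₂ i)
    (Kc := fun i => (12 * 𝓐₀ i / R i * Real.sqrt (Nat.card {b : PBond (F.P Kt) 0 // b.src ∈ maxDomT ν.M₁ (Z i) 1})))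
    (τc := fun i => (8 * (((F.P Kt).d : ℝ) + 1) * (2 * (Kτ i + 1) * δ i) + 8 * ((F.P Kt).d : ℝ) * (((box (fun κ => (hi i κ - lo i κ + 1).toNat + 3) (fun κ => lo i κ - 2)).image (fun z => (castSite z : Site (F.P Kt) (k i)))).card : ℝ) * (C i * δ i * (12 * 𝓐₀ i / R i * Real.sqrt (Nat.card {b : PBond (F.P Kt) 0 // b.src ∈ maxDomT ν.M₁ (Z i) 1}))) ^ 2))
    (fun i => (hδpos i).le) (fun i => (hδpos i).le) hμc0
    hσW
    (fun i Vk hg hdat U₀ hmin p _ hp => hPχ i Vk hg hdat U₀ hmin p hp)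
    (fun i Vk hg hdat U₀ Xf hmin _ hfeeds hX0 hC2 hfam hK' hsupp => ?_)
    (fun i => ?_) hγle hfar hZblk hM2 hdiv hcE0 hcE hB₃ heRa ha₀ hcA h15T hcJ'
  · -- (χ)_W from the chart half at the (P4)′ witness
    obtain ⟨H, hHinv, hHB⟩ := hH i Vk hg hdat U₀ hmin
    obtain ⟨Ψ₂, lam, p, h1, h2, h3, h4, h5⟩ := hhalf i ν (Z i) (Λ i) (T i) (lo i) (hi i) (hbox3 i) (hΩw i) (hk1 i) hM4 (hdiv i) hεreg.le (hερ i) (ext i) Vk (hR i) (h𝓐₀ i) U₀ Xf hmin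
      (hδpos i).le
      (hPχ i Vk hg hdat U₀ hmin) H (hB0 i) hHinv hHB (hM₂0 i) (hM₂ i Vk hg hdat U₀ hmin) hX0 hC2 hfam hK' hsupp (W i) (hWbox i) (hδpos i) (hδρ i) (hδρτ i) hfeeds
    refine ⟨Ψ₂, lam, p, h1, h2, h3, h4, fun X => ⟨?_, (h5 X).2.1, ?_⟩⟩
    · have := (h5 X).1
      calc lam (Ψ₂ (fderiv ℝ Xf 0 X) (fderiv ℝ Xf 0 X))
          ≤ (2 * (((F.P Kt).d : ℝ) - 1) * δ i * Real.sqrt (Fintype.card (PBond (F.P Kt) 0)) * B i * M₂ i) * p (fderiv ℝ Xf 0 X) ^ 2 := this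
        _ = _ := rfl
    · have hc := (h5 X).2.2
      rw [hA i, one_mul] at hc
      exact hc
  · -- the numerics `hsm` at the pinned constants, from the thresholds
    have hμ : 2 * (((F.P Kt).d : ℝ) - 1) * δ i * Real.sqrt (Fintype.card (PBond (F.P Kt) 0)) * B i * M₂ i ≤ (2 * (((F.P Kt).d : ℝ) - 1) * Real.sqrt (Fintype.card (PBond (F.P Kt) 0)) * B i * M₂ i) * δ i :=
      le_of_eq (by ring)
    exact hsm_direct_of_le_explicitThreshold hd1 (hK1 i) (by norm_num) _ 1 _ _ (hδpos i).le (hδΘ i) le_rfl (by rw [one_mul]) hμ (hτ i)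

end Summit.QuantumFields.YangMills.BalabanUVNodes.N12Prop1DirectOfChartHalfOfClassExplicit

end
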